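import Summits.BirchSwinnertonDyer.BirchSwinnertonDyer.Theorems.ManinLocalTwoThreeKummerCubeRootSigmaPrelims
import Summits.BirchSwinnertonDyer.BirchSwinnertonDyer.Theorems.ManinLocalTwoThreeKummerCubeSigmaTangentLine
import Summits.BirchSwinnertonDyer.BirchSwinnertonDyer.Theorems.ManinLocalTwoThreeSigmaSquareRootLeaves
import HarnessLib

/-!
# (AN2-d) Holomorphic extension of `B·t_s·(X/σ)(c·E_f)` across the poles: the two-chart argument
(route `ManinLocalTwoThree`, crux C3 `ManinPrimeToThreeAtNine` stmt-BirchSwinnertonDyer-22968 — and verbatim for C2's `ℓ = 2` twin; cell bsd-f2-manin,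
p2 gen 17; `--supports stmt-BirchSwinnertonDyer-22968`; the «`F` is holomorphic on `ℍ`» clause of C3 v23's `stub_kummerCubeRootModularFormWitness`)

For the σ-Kummer block `G = t_s·V(w)`, `w = c·E_f(τ)`, `V = X/σ` (`X` entire: `X = e^{ew/3}σ(w − u)` gives `V = W_u = sigmaCubeRoot`, `X = e^{ew/2}σ(w − a)`
gives `V = V_a = sigmaSqRoot`), and ANY holomorphic `B, B′ : ℍ → ℂ` tied to `t_s` through a holomorphic presentation `t_s·B₀ = A` (`B₀ ≢ 0`) by
`A·B = B₀·B′` (so `B′ = B·t_s` wherever `B₀ ≠ 0`), the function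
`F = B′·V(w)` on `{σ(w) ≠ 0}`,  `F = B·Φ(w)` on `{P₃(w) ≠ 0}`  (`Φ = −2P₂X/(cP₃)`, `P₂ = ℘σ²`, `P₃ = ℘′σ³` entire)
is well defined and HOLOMORPHIC ON ALL OF `ℍ`: the two open sets cover `ℍ` because **`P₃` does not vanish on `Λ`**
(`ne_zero_of_mem_lattice_of_eq_derivWeierstrassP_mul_sigma_cube`: `P₃(w + λ) = c_λ³e^{3η_λ w}P₃(w)` by the quasi-periodicity of `σ`, density of `ℂ ∖ Λ`
and `P₃(0) = −2`), and on the overlap the two expressions agree off the isolated zeros of `B₀` (identity theorem on the connected `ℍ`).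
NO order bookkeeping, NO algebraicity of `j` on `φ⁻¹(E[2])` is used.  PROVED here (no sorry, no definition):
`exists_sigmaKummer_package` (the chart-2 function `Φ`), `eventually_ne_zero_of_mdifferentiable` (isolated zeros on `ℍ`),
**`exists_mdifferentiable_extension`** (general `X`), **`exists_mdifferentiable_sigmaCubeRoot_extension`** (`ℓ = 3`),
**`exists_mdifferentiable_sigmaSqRoot_extension`** (`ℓ = 2`).
HONEST FRAMING.  Kernel step of the witness; the inputs `B, B′` (a RATIONAL holomorphic `Γ₀(N)`-form `B` with `B·t_s` holomorphic) are where the one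
print fact of the line enters (S69: `K_N ∩ ℚ((q)) = ℚ(j, j_N)`, Lang *Elliptic Functions* Ch. 6 §4 Thm 5 Cor. 2); growth at the other cusps and
integrality are separate steps.  BSD is not proved by this; Manin's conjecture is not proved; C2 and C3 remain OPEN.
[folklore]
-/

set_option autoImplicit false
-- lint-debt: the directory name repeats the summit name (sibling precedent `ManinLocalTwoThreeKummerCubeRootSigmaPrelims.lean`)
set_option linter.dupNamespace false

noncomputable section

open scoped Topology PeriodPair MatrixGroups Manifold
open Complex Filter
open UpperHalfPlane hiding I
open Literature.NumberTheory.EllipticCurves Literature.NumberTheory.EllipticCurves.ModularForms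
open Summit.BirchSwinnertonDyer.Rank1Residual.ManinAdditive.KummerCubeMonodromy
open Summit.BirchSwinnertonDyer.BirchSwinnertonDyer.Theorems.ManinLocalTwoThree.KummerCubeSigmaLeaves
open Summit.BirchSwinnertonDyer.BirchSwinnertonDyer.Theorems.ManinLocalTwoThree.SigmaSquareRoot

namespace Summit.BirchSwinnertonDyer.BirchSwinnertonDyer.Theorems.ManinLocalTwoThree.KummerCubeRootDictionary

variable {W : WeierstrassCurve ℚ} {N : ℕ} [NeZero N]

/-! ### §1 `P₃ = ℘′σ³` does not vanish on the lattice -/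

/-- **`P₃(λ) ≠ 0` for `λ ∈ Λ`**: from `σ(z + λ) = c·e^{ηz}σ(z)` and the periodicity of `℘′`, `P₃(w + λ) = c³e^{3ηw}P₃(w)` off `Λ`, hence
everywhere (both sides continuous, `ℂ ∖ Λ` dense); at `w = 0` this is `P₃(λ) = −2c³`. [folklore] -/
theorem ne_zero_of_mem_lattice_of_eq_derivWeierstrassP_mul_sigma_cube (L : PeriodPair) {P₃ : ℂ → ℂ}
    (hP₃ : Differentiable ℂ P₃) (h0 : P₃ 0 = -2)
    (heq : ∀ w, w ∉ L.lattice → P₃ w = ℘'[L] w * L.weierstrassSigma w ^ 3) {l : ℂ} (hl : l ∈ L.lattice) :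
    P₃ l ≠ 0 := by
  obtain ⟨m₁, m₂, hm⟩ := PeriodPair.mem_lattice.mp hl
  obtain ⟨c, hc, -, hper⟩ := exists_weierstrassSigma_add_period L m₁ m₂
  rw [hm] at hper
  have hσc : Continuous L.weierstrassSigma := L.differentiable_weierstrassSigma_holds.continuous
  have h1 : Continuous fun w => P₃ (w + l) := hP₃.continuous.comp (continuous_id.add continuous_const)
  have h2 : Continuous fun w => c ^ 3 * cexp ((m₁ * L.η₁ + m₂ * L.η₂) * w) ^ 3 * P₃ w :=
    (continuous_const.mul ((continuous_const.mul continuous_id).cexp.pow 3)).mul hP₃.continuous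
  have hdense : Dense ((L.lattice : Set ℂ)ᶜ) := L.countable_lattice.dense_compl ℂ
  have heqOn : Set.EqOn (fun w => P₃ (w + l)) (fun w => c ^ 3 * cexp ((m₁ * L.η₁ + m₂ * L.η₂) * w) ^ 3 * P₃ w)
      ((L.lattice : Set ℂ)ᶜ) := by
    intro w hw
    have hw' : w ∉ L.lattice := hw
    have hwl : w + l ∉ L.lattice := fun h => hw' (by simpa using L.lattice.sub_mem h hl)
    have hp : ℘'[L] (w + l) = ℘'[L] w := by simpa using L.derivWeierstrassP_add_coe w ⟨l, hl⟩
    simp only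
    rw [heq _ hwl, heq _ hw', hper w, hp]
    ring
  have hfun := Continuous.ext_on hdense h1 h2 heqOn
  have h0' := congrFun hfun 0
  simp only [zero_add, mul_zero, Complex.exp_zero, one_pow, mul_one, h0] at h0'
  rw [h0']
  exact mul_ne_zero (pow_ne_zero 3 hc) (by norm_num)

/-! ### §2 The chart-2 function `Φ = −2P₂X/(cP₃)` -/

/-- **The σ-Kummer package.**  For an entire `X` there are an entire `P₃`, non-vanishing on `Λ`, whose zeros off `Λ` are exactly those of `℘′`,
and a function `Φ`, complex-differentiable wherever `P₃ ≠ 0`, with `t_s(τ)·X(w)/σ(w) = Φ(w)` for `w = c·E_f(τ) ∉ Λ`, `P₃(w) ≠ 0`.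
[folklore] -/
theorem exists_sigmaKummer_package (D : ModularParametrizationData W N) (hc0 : D.c ≠ 0) {X : ℂ → ℂ} (hX : Differentiable ℂ X) :
    ∃ P₃ Φ : ℂ → ℂ, Differentiable ℂ P₃ ∧ (∀ l ∈ D.L.lattice, P₃ l ≠ 0) ∧
      (∀ w, w ∉ D.L.lattice → P₃ w ≠ 0 → ℘'[D.L] w ≠ 0) ∧
      (∀ w, w ∉ D.L.lattice → ℘'[D.L] w ≠ 0 → P₃ w ≠ 0) ∧
      (∀ w, P₃ w ≠ 0 → DifferentiableAt ℂ Φ w) ∧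
      ∀ τ : ℍ, (D.c : ℂ) * eichlerIntegral D.f τ ∉ D.L.lattice → P₃ ((D.c : ℂ) * eichlerIntegral D.f τ) ≠ 0 →
        shortT D τ * (X ((D.c : ℂ) * eichlerIntegral D.f τ) / D.L.weierstrassSigma ((D.c : ℂ) * eichlerIntegral D.f τ)) =
          Φ ((D.c : ℂ) * eichlerIntegral D.f τ) := by
  obtain ⟨P₂, P₃, hP₂, hP₃, -, hP₃0, hP₂eq, hP₃eq⟩ := exists_entire_weierstrassP_sigma_values D.L
  have hc : (D.c : ℂ) ≠ 0 := Int.cast_ne_zero.mpr hc0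
  have hσne : ∀ w, w ∉ D.L.lattice → D.L.weierstrassSigma w ≠ 0 := fun w hw h =>
    hw ((D.L.weierstrassSigma_eq_zero_iff_holds w).mp h)
  refine ⟨P₃, fun w => -2 * P₂ w * X w / ((D.c : ℂ) * P₃ w), hP₃, ?_, ?_, ?_, ?_, ?_⟩
  · intro l hl
    exact ne_zero_of_mem_lattice_of_eq_derivWeierstrassP_mul_sigma_cube D.L hP₃ hP₃0 hP₃eq hl
  · intro w hw hP h℘
    apply hP
    rw [hP₃eq w hw, h℘, zero_mul]
  · intro w hw h℘ hP
    rw [hP₃eq w hw] at hP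
    rcases mul_eq_zero.mp hP with h | h
    · exact h℘ h
    · exact hσne w hw (pow_eq_zero_iff (three_ne_zero) |>.mp h)
  · intro w hw
    have hnum : DifferentiableAt ℂ (fun w => -2 * P₂ w * X w) w :=
      ((differentiableAt_const _).mul (hP₂ w)).mul (hX w)
    have hden : DifferentiableAt ℂ (fun w => (D.c : ℂ) * P₃ w) w := (differentiableAt_const _).mul (hP₃ w)
    exact hnum.div hden (mul_ne_zero hc hw)
  · intro τ hw hP₃w
    set w : ℂ := (D.c : ℂ) * eichlerIntegral D.f τ with hw_def
    have hσw := hσne w hw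
    have h℘ : ℘[D.L] w = P₂ w / D.L.weierstrassSigma w ^ 2 := by
      rw [hP₂eq w hw]; field_simp
    have h℘' : ℘'[D.L] w = P₃ w / D.L.weierstrassSigma w ^ 3 := by
      rw [hP₃eq w hw]; field_simp
    rw [shortT, shortX, shortY, ← hw_def, h℘, h℘']
    field_simp

/-! ### §3 Isolated zeros on `ℍ` -/

/-- A holomorphic function on `ℍ` which is not identically zero is non-zero on a punctured neighbourhood of every point (identity theorem on the
connected upper half-plane, in the complex coordinate). [folklore] -/
theorem eventually_ne_zero_of_mdifferentiable {g : ℍ → ℂ} (hg : MDifferentiable 𝓘(ℂ) 𝓘(ℂ) g) (hne : ∃ τ, g τ ≠ 0) (τ₀ : ℍ) :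
    ∀ᶠ z in 𝓝[≠] ((τ₀ : ℍ) : ℂ), (g ∘ ofComplex) z ≠ 0 := by
  have han : AnalyticOnNhd ℂ (g ∘ ofComplex) {z : ℂ | 0 < z.im} := fun z hz =>
    (UpperHalfPlane.mdifferentiable_iff.mp hg).analyticAt (isOpen_upperHalfPlaneSet.mem_nhds hz)
  by_contra hcon
  have hfreq : ∃ᶠ z in 𝓝[≠] ((τ₀ : ℍ) : ℂ), (g ∘ ofComplex) z = 0 := by
    simpa [Filter.not_eventually] using hcon
  have heq := han.eqOn_zero_of_preconnected_of_frequently_eq_zero convex_setOf_im_pos.isPreconnected τ₀.im_pos hfreq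
  obtain ⟨τ, hτ⟩ := hne
  exact hτ (by simpa [Function.comp_apply, ofComplex_apply] using heq τ.im_pos)

/-! ### §4 The extension theorem -/

/-- **(AN2-d) Holomorphic extension, general `X`.**  See the file header: given holomorphic `B₀ ≢ 0`, `B`, `B′` on `ℍ` with `t_s·B₀ = A` off the
poles of `t_s` and `A·B = B₀·B′`, there is a HOLOMORPHIC `F : ℍ → ℂ` with `F = B′·X(w)/σ(w)` wherever `w = c·E_f(τ) ∉ Λ`, hence
`F = B·t_s·X(w)/σ(w)` wherever moreover `℘′(w) ≠ 0` and `B₀(τ) ≠ 0`. [folklore] -/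
theorem exists_mdifferentiable_extension (D : ModularParametrizationData W N) (hc0 : D.c ≠ 0)
    {X : ℂ → ℂ} (hX : Differentiable ℂ X) {A B₀ B B' : ℍ → ℂ}
    (hB₀ : MDifferentiable 𝓘(ℂ) 𝓘(ℂ) B₀) (hB₀ne : ∃ τ, B₀ τ ≠ 0)
    (hB : MDifferentiable 𝓘(ℂ) 𝓘(ℂ) B) (hB' : MDifferentiable 𝓘(ℂ) 𝓘(ℂ) B')
    (hpres : ∀ τ : ℍ, (D.c : ℂ) * eichlerIntegral D.f τ ∉ D.L.lattice →
      ℘'[D.L] ((D.c : ℂ) * eichlerIntegral D.f τ) ≠ 0 → shortT D τ * B₀ τ = A τ)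
    (hrel : ∀ τ : ℍ, A τ * B τ = B₀ τ * B' τ) :
    ∃ F : ℍ → ℂ, MDifferentiable 𝓘(ℂ) 𝓘(ℂ) F ∧
      (∀ τ : ℍ, (D.c : ℂ) * eichlerIntegral D.f τ ∉ D.L.lattice →
        F τ = B' τ * (X ((D.c : ℂ) * eichlerIntegral D.f τ) / D.L.weierstrassSigma ((D.c : ℂ) * eichlerIntegral D.f τ))) ∧
      (∀ τ : ℍ, (D.c : ℂ) * eichlerIntegral D.f τ ∉ D.L.lattice → ℘'[D.L] ((D.c : ℂ) * eichlerIntegral D.f τ) ≠ 0 → B₀ τ ≠ 0 →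
        F τ = B τ * (shortT D τ *
          (X ((D.c : ℂ) * eichlerIntegral D.f τ) / D.L.weierstrassSigma ((D.c : ℂ) * eichlerIntegral D.f τ)))) := by
  classical
  obtain ⟨P₃, Φ, hP₃d, hP₃Λ, h℘ne, -, hΦd, hΦeq⟩ := exists_sigmaKummer_package D hc0 hX
  have hσd : Differentiable ℂ D.L.weierstrassSigma := D.L.differentiable_weierstrassSigma_holds
  have hσne : ∀ w, w ∉ D.L.lattice → D.L.weierstrassSigma w ≠ 0 := fun w hw h =>
    hw ((D.L.weierstrassSigma_eq_zero_iff_holds w).mp h)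
  -- `B′ = B·t_s` wherever `B₀ ≠ 0`
  have hkey : ∀ τ : ℍ, (D.c : ℂ) * eichlerIntegral D.f τ ∉ D.L.lattice →
      ℘'[D.L] ((D.c : ℂ) * eichlerIntegral D.f τ) ≠ 0 → B₀ τ ≠ 0 → B' τ = B τ * shortT D τ := by
    intro τ hw h℘ hB₀τ
    have h1 := hpres τ hw h℘
    have h2 := hrel τ
    have h3 : B₀ τ * B' τ = B₀ τ * (B τ * shortT D τ) := by rw [← h2, ← h1]; ring
    exact mul_left_cancel₀ hB₀τ h3
  refine ⟨fun τ => if (D.c : ℂ) * eichlerIntegral D.f τ ∈ D.L.lattice then B τ * Φ ((D.c : ℂ) * eichlerIntegral D.f τ)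
      else B' τ * (X ((D.c : ℂ) * eichlerIntegral D.f τ) / D.L.weierstrassSigma ((D.c : ℂ) * eichlerIntegral D.f τ)),
    ?_, fun τ hw => by simp only [if_neg hw], fun τ hw h℘ hB₀τ => by simp only [if_neg hw, hkey τ hw h℘ hB₀τ, mul_assoc]⟩
  -- holomorphy, in the complex coordinate
  intro τ₀
  rw [UpperHalfPlane.mdifferentiableAt_iff]
  have hEd : DifferentiableAt ℂ (fun z : ℂ => (D.c : ℂ) * eichlerIntegral D.f (ofComplex z)) (τ₀ : ℂ) :=
    (differentiableAt_const _).mul (hasDerivAt_eichlerIntegral D.f τ₀.im_pos).differentiableAt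
  have hBd : DifferentiableAt ℂ (B ∘ ofComplex) (τ₀ : ℂ) := UpperHalfPlane.mdifferentiableAt_iff.mp (hB τ₀)
  have hB'd : DifferentiableAt ℂ (B' ∘ ofComplex) (τ₀ : ℂ) := UpperHalfPlane.mdifferentiableAt_iff.mp (hB' τ₀)
  have hw0 : (D.c : ℂ) * eichlerIntegral D.f (ofComplex (τ₀ : ℂ)) = (D.c : ℂ) * eichlerIntegral D.f τ₀ := by
    rw [ofComplex_apply]
  by_cases hΛ0 : (D.c : ℂ) * eichlerIntegral D.f τ₀ ∈ D.L.lattice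
  · -- chart 2: `w(τ₀) ∈ Λ`, so `P₃(w(τ₀)) ≠ 0`
    have hP0 : P₃ ((D.c : ℂ) * eichlerIntegral D.f (ofComplex (τ₀ : ℂ))) ≠ 0 := by
      rw [hw0]; exact hP₃Λ _ hΛ0
    have hev1 : ∀ᶠ z in 𝓝 (τ₀ : ℂ), P₃ ((D.c : ℂ) * eichlerIntegral D.f (ofComplex z)) ≠ 0 :=
      ((hP₃d.continuous.continuousAt).comp_of_eq hEd.continuousAt rfl).eventually_ne hP0
    have hev2 : ∀ᶠ z in 𝓝 (τ₀ : ℂ), 0 < z.im := isOpen_upperHalfPlaneSet.mem_nhds τ₀.im_pos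
    have hev3 := eventually_nhdsWithin_iff.mp (eventually_ne_zero_of_mdifferentiable hB₀ hB₀ne τ₀)
    have hFeq : ((fun τ => if (D.c : ℂ) * eichlerIntegral D.f τ ∈ D.L.lattice then B τ * Φ ((D.c : ℂ) * eichlerIntegral D.f τ)
          else B' τ * (X ((D.c : ℂ) * eichlerIntegral D.f τ) / D.L.weierstrassSigma ((D.c : ℂ) * eichlerIntegral D.f τ))) ∘
            ofComplex) =ᶠ[𝓝 (τ₀ : ℂ)]
        fun z => (B ∘ ofComplex) z * Φ ((D.c : ℂ) * eichlerIntegral D.f (ofComplex z)) := by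
      filter_upwards [hev1, hev2, hev3] with z h1 _h2 h3
      simp only [Function.comp_apply]
      by_cases hz : (D.c : ℂ) * eichlerIntegral D.f (ofComplex z) ∈ D.L.lattice
      · rw [if_pos hz]
      · rw [if_neg hz]
        have hne : z ≠ (τ₀ : ℂ) := by
          rintro rfl
          rw [hw0] at hz
          exact hz hΛ0
        have hB₀z : B₀ (ofComplex z) ≠ 0 := h3 (Set.mem_compl_singleton_iff.mpr hne)
        have h℘ : ℘'[D.L] ((D.c : ℂ) * eichlerIntegral D.f (ofComplex z)) ≠ 0 := h℘ne _ hz h1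
        rw [hkey (ofComplex z) hz h℘ hB₀z, mul_assoc, hΦeq (ofComplex z) hz h1]
    have hg : DifferentiableAt ℂ (fun z => (B ∘ ofComplex) z * Φ ((D.c : ℂ) * eichlerIntegral D.f (ofComplex z))) (τ₀ : ℂ) :=
      hBd.mul ((hΦd _ hP0).comp (τ₀ : ℂ) hEd)
    exact hFeq.differentiableAt_iff.mpr hg
  · -- chart 1: `w(τ₀) ∉ Λ`, an open condition
    have hopen : IsOpen ((D.L.lattice : Set ℂ)ᶜ) := D.L.isClosed_lattice.isOpen_compl
    have hmem : (D.c : ℂ) * eichlerIntegral D.f (ofComplex (τ₀ : ℂ)) ∈ ((D.L.lattice : Set ℂ)ᶜ) := by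
      rw [hw0]; exact hΛ0
    have hev : ∀ᶠ z in 𝓝 (τ₀ : ℂ), (D.c : ℂ) * eichlerIntegral D.f (ofComplex z) ∉ D.L.lattice :=
      hEd.continuousAt.preimage_mem_nhds (hopen.mem_nhds hmem)
    have hFeq : ((fun τ => if (D.c : ℂ) * eichlerIntegral D.f τ ∈ D.L.lattice then B τ * Φ ((D.c : ℂ) * eichlerIntegral D.f τ)
          else B' τ * (X ((D.c : ℂ) * eichlerIntegral D.f τ) / D.L.weierstrassSigma ((D.c : ℂ) * eichlerIntegral D.f τ))) ∘
            ofComplex) =ᶠ[𝓝 (τ₀ : ℂ)]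
        fun z => (B' ∘ ofComplex) z * (X ((D.c : ℂ) * eichlerIntegral D.f (ofComplex z)) /
          D.L.weierstrassSigma ((D.c : ℂ) * eichlerIntegral D.f (ofComplex z))) := by
      filter_upwards [hev] with z hz
      simp only [Function.comp_apply]
      rw [if_neg hz]
    have hσ0 : D.L.weierstrassSigma ((D.c : ℂ) * eichlerIntegral D.f (ofComplex (τ₀ : ℂ))) ≠ 0 := by
      rw [hw0]; exact hσne _ hΛ0
    have hXz : DifferentiableAt ℂ (fun z : ℂ => X ((D.c : ℂ) * eichlerIntegral D.f (ofComplex z))) (τ₀ : ℂ) :=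
      (hX _).comp (τ₀ : ℂ) hEd
    have hσz : DifferentiableAt ℂ (fun z : ℂ => D.L.weierstrassSigma ((D.c : ℂ) * eichlerIntegral D.f (ofComplex z))) (τ₀ : ℂ) :=
      (hσd _).comp (τ₀ : ℂ) hEd
    have hg : DifferentiableAt ℂ (fun z => (B' ∘ ofComplex) z * (X ((D.c : ℂ) * eichlerIntegral D.f (ofComplex z)) /
        D.L.weierstrassSigma ((D.c : ℂ) * eichlerIntegral D.f (ofComplex z)))) (τ₀ : ℂ) :=
      hB'd.mul (hXz.div hσz hσ0)
    exact hFeq.differentiableAt_iff.mpr hg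

/-- **(AN2-d) at `ℓ = 3`**: the holomorphic extension of `B·t_s·W_u(c·E_f)` (`W_u = sigmaCubeRoot D.L u e`). [folklore] -/
theorem exists_mdifferentiable_sigmaCubeRoot_extension (D : ModularParametrizationData W N) (hc0 : D.c ≠ 0) (u e : ℂ)
    {A B₀ B B' : ℍ → ℂ} (hB₀ : MDifferentiable 𝓘(ℂ) 𝓘(ℂ) B₀) (hB₀ne : ∃ τ, B₀ τ ≠ 0)
    (hB : MDifferentiable 𝓘(ℂ) 𝓘(ℂ) B) (hB' : MDifferentiable 𝓘(ℂ) 𝓘(ℂ) B')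
    (hpres : ∀ τ : ℍ, (D.c : ℂ) * eichlerIntegral D.f τ ∉ D.L.lattice →
      ℘'[D.L] ((D.c : ℂ) * eichlerIntegral D.f τ) ≠ 0 → shortT D τ * B₀ τ = A τ)
    (hrel : ∀ τ : ℍ, A τ * B τ = B₀ τ * B' τ) :
    ∃ F : ℍ → ℂ, MDifferentiable 𝓘(ℂ) 𝓘(ℂ) F ∧
      (∀ τ : ℍ, (D.c : ℂ) * eichlerIntegral D.f τ ∉ D.L.lattice →
        F τ = B' τ * sigmaCubeRoot D.L u e ((D.c : ℂ) * eichlerIntegral D.f τ)) ∧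
      (∀ τ : ℍ, (D.c : ℂ) * eichlerIntegral D.f τ ∉ D.L.lattice → ℘'[D.L] ((D.c : ℂ) * eichlerIntegral D.f τ) ≠ 0 → B₀ τ ≠ 0 →
        F τ = B τ * (shortT D τ * sigmaCubeRoot D.L u e ((D.c : ℂ) * eichlerIntegral D.f τ))) := by
  have hX : Differentiable ℂ (fun w => cexp (e * w / 3) * D.L.weierstrassSigma (w - u)) :=
    (((differentiable_const _).mul differentiable_id).div_const _).cexp.mul
      (D.L.differentiable_weierstrassSigma_holds.comp (differentiable_id.sub_const u))
  obtain ⟨F, hF, h1, h2⟩ := exists_mdifferentiable_extension D hc0 hX hB₀ hB₀ne hB hB' hpres hrel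
  exact ⟨F, hF, fun τ hw => by simpa only [sigmaCubeRoot] using h1 τ hw,
    fun τ hw h℘ hB₀τ => by simpa only [sigmaCubeRoot] using h2 τ hw h℘ hB₀τ⟩

/-- **(AN2-d) at `ℓ = 2`**: the holomorphic extension of `B·t_s·V_a(c·E_f)` (`V_a = sigmaSqRoot D.L a e`). [folklore] -/
theorem exists_mdifferentiable_sigmaSqRoot_extension (D : ModularParametrizationData W N) (hc0 : D.c ≠ 0) (a e : ℂ)
    {A B₀ B B' : ℍ → ℂ} (hB₀ : MDifferentiable 𝓘(ℂ) 𝓘(ℂ) B₀) (hB₀ne : ∃ τ, B₀ τ ≠ 0)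
    (hB : MDifferentiable 𝓘(ℂ) 𝓘(ℂ) B) (hB' : MDifferentiable 𝓘(ℂ) 𝓘(ℂ) B')
    (hpres : ∀ τ : ℍ, (D.c : ℂ) * eichlerIntegral D.f τ ∉ D.L.lattice →
      ℘'[D.L] ((D.c : ℂ) * eichlerIntegral D.f τ) ≠ 0 → shortT D τ * B₀ τ = A τ)
    (hrel : ∀ τ : ℍ, A τ * B τ = B₀ τ * B' τ) :
    ∃ F : ℍ → ℂ, MDifferentiable 𝓘(ℂ) 𝓘(ℂ) F ∧
      (∀ τ : ℍ, (D.c : ℂ) * eichlerIntegral D.f τ ∉ D.L.lattice →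
        F τ = B' τ * sigmaSqRoot D.L a e ((D.c : ℂ) * eichlerIntegral D.f τ)) ∧
      (∀ τ : ℍ, (D.c : ℂ) * eichlerIntegral D.f τ ∉ D.L.lattice → ℘'[D.L] ((D.c : ℂ) * eichlerIntegral D.f τ) ≠ 0 → B₀ τ ≠ 0 →
        F τ = B τ * (shortT D τ * sigmaSqRoot D.L a e ((D.c : ℂ) * eichlerIntegral D.f τ))) := by
  have hX : Differentiable ℂ (fun w => cexp (e * w / 2) * D.L.weierstrassSigma (w - a)) :=
    (((differentiable_const _).mul differentiable_id).div_const _).cexp.mul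
      (D.L.differentiable_weierstrassSigma_holds.comp (differentiable_id.sub_const a))
  obtain ⟨F, hF, h1, h2⟩ := exists_mdifferentiable_extension D hc0 hX hB₀ hB₀ne hB hB' hpres hrel
  exact ⟨F, hF, fun τ hw => by simpa only [sigmaSqRoot] using h1 τ hw,
    fun τ hw h℘ hB₀τ => by simpa only [sigmaSqRoot] using h2 τ hw h℘ hB₀τ⟩

end Summit.BirchSwinnertonDyer.BirchSwinnertonDyer.Theorems.ManinLocalTwoThree.KummerCubeRootDictionary

end
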